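import Summits.QuantumFields.BalabanUV.Beta.D1BFx.ProjectorJet

/-!
# `BalabanUV.Beta.D1BFx.ProjectorJetStripped` — road «BF-x» for binder row D1, leaf J5 (MODEL LEVEL): the COLOUR-STRIPPED reading of the
# jet of Bałaban's gauge coprojector — the SKEW jet `cojetSkew`, its Leibniz characterisation with uniqueness, and THE STRIPPING LEMMA
# `cojet (X ⊗ₖ 1) (Ẋ ⊗ₖ A) = cojetSkew X Ẋ ⊗ₖ A` for a skew colour insertion `Aᴴ = −A`

HONEST FRAMING (cell contract, verbatim): «discharging `BetaPertH` makes Bałaban's UV stability UNCONDITIONAL — a real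
constructive-QFT result; it is NOT the continuum limit and NOT the Clay problem.»  HONEST DEPENDENCY (verbatim): «continuum YM on
T⁴ ⇐ BetaPertH ∧ nine spine estimates (0/9 proved); BetaPertH ⇐ (D1) ∧ (D4) ∧ CAP+tail; G-an2-4 gates asym, D1 and NE2/3/4.»
[folklore] matrix algebra (Mathlib `Matrix`, `conjTranspose`, `nonsing_inv`, the Kronecker product `⊗ₖ` with `mul_kronecker_mul`,
`inv_kronecker`, `conjTranspose_kronecker`) over `D1BFx/ProjectorJet` (p211500) and gan24-p3's `WoodburyFibreGaugeSection.coproj` BY NAME.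
Cites nothing as a hypothesis, mints no `Prop`; 0 binders of row D1 instantiated; NOT D1, NOT BetaPertH, NOT continuum, NOT Clay.

WHY (skeleton `HOME/beta/skeletons/D1-b2b-balaban-beta-d1-p2.md` v1.4 node J, leaf J5; typer spec `TYPER-SPEC-D1BFx.md` §1 T6/§3 J5; leaf-09-g2's
seat-closing caveat CLAIMS l.8129 «J5 proper … typeable now … once the ∂D stripping convention is pinned against T6's `ghCur`»).  Road BF-x
records every FIRST-ORDER background jet COLOUR-STRIPPED (`Beta.StepJetData` §5): the jet of a symmetric operator on `𝔤`-valued lattice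
functions along the background direction `B = b·t_c` at one bond is `V_s ⊗ ad(t_c)`, and what is typed is the SITE kernel `V_s` — e.g. the
typer's T6 `GhostStencil.ghCur`/`qAnti`/`Sgh` (antisymmetric site kernels: `Sgh_antisymm`), the colour matrix `ad(t_c)` being SKEW for the
Killing form.  `D1BFx/ProjectorJet` computed the jet of the FULL coprojector (`cojet`, Hermitian).  This file says what the STRIPPED jet
is: with the U = 1 objects colour-blind (`X ⊗ₖ 1`, hence `R ⊗ₖ 1`, `X⁺ ⊗ₖ 1` — §2) and the column variation `Ẋ = Ẋ_s ⊗ₖ A`, `Aᴴ = −A`,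
**`cojet (X ⊗ₖ 1) (Ẋ_s ⊗ₖ A) = cojetSkew X Ẋ_s ⊗ₖ A`** (`cojet_kronecker_of_skew`), where
`cojetSkew X Y := −(R·Y·X⁺ − (R·Y·X⁺)ᴴ)` is SKEW (`(cojetSkew)ᴴ = −cojetSkew`) and is CHARACTERISED (`cojetSkew_unique`, hypothesis-free)
by: skew ∧ `R·Z + Z·R = Z` ∧ `Z·X + R·Y = 0`.  So the kernel-level J5 object (the stripped jet of `R` at U = 1, to be composed from
`RProjector.Pker`/`GhostLeg.Ggh`/T6's stencils) is an ANTISYMMETRIC site kernel with exactly these two Leibniz identities as its socket,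
and its closed form along `(Ḣ, Q̇) = (V, Q̇)` with `V` skew is (§3, `cojetSkew_balaban_of_skew`)
**`Ṙ_s = R·H⁻¹·V·P + P·V·H⁻¹·R − R·H⁻¹·Q̇ᴴ·X⁺ + (R·H⁻¹·Q̇ᴴ·X⁺)ᴴ`** — same `V`-corners as the Hermitian reading, OPPOSITE relative sign
of the two `Q̇`-corners.  For a Hermitian (e.g. abelian, `A = 1`) insertion the full and stripped jets agree (`cojet_kronecker_of_isHermitian`).
-/

namespace Summit.QuantumFields.BalabanUV.Beta.D1BFx.ProjectorJetStripped

open Matrix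
open scoped Kronecker
open Summit.QuantumFields.BalabanUV.Beta.GAN24.WoodburyFibreGaugeSection
  (coproj gram_conjTranspose conjTranspose_mul_coproj coproj_mul_self coproj_conjTranspose coproj_mul_coproj)
open Summit.QuantumFields.BalabanUV.Beta.D1BFx.ProjectorJet
  (pinv cojet pinv_mul_self self_mul_pinv one_sub_self_mul_pinv pinv_mul_coproj coproj_mul_pinv_conjTranspose coproj_mul_term
    coproj_mul_term_conjTranspose term_mul_coproj term_conjTranspose_mul_coproj term_mul_self term_conjTranspose_mul_self)

section KroneckerHelpers

variable {𝕜 : Type*} [Ring 𝕜] {m n p q : Type*}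

/-- [folklore] `(A − B) ⊗ₖ C = A ⊗ₖ C − B ⊗ₖ C`. -/
theorem sub_kronecker (A B : Matrix n m 𝕜) (C : Matrix p q 𝕜) : (A - B) ⊗ₖ C = A ⊗ₖ C - B ⊗ₖ C := by
  ext ⟨i, k⟩ ⟨j, l⟩
  simp [sub_mul]

/-- [folklore] `(−A) ⊗ₖ C = −(A ⊗ₖ C)`. -/
theorem neg_kronecker (A : Matrix n m 𝕜) (C : Matrix p q 𝕜) : (-A) ⊗ₖ C = -(A ⊗ₖ C) := by
  ext ⟨i, k⟩ ⟨j, l⟩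
  simp

/-- [folklore] `A ⊗ₖ (−C) = −(A ⊗ₖ C)`. -/
theorem kronecker_neg (A : Matrix n m 𝕜) (C : Matrix p q 𝕜) : A ⊗ₖ (-C) = -(A ⊗ₖ C) := by
  ext ⟨i, k⟩ ⟨j, l⟩
  simp

end KroneckerHelpers

section Skew

variable {𝕜 : Type*} [Field 𝕜] [StarRing 𝕜]
variable {m n : Type*} [Fintype m] [Fintype n] [DecidableEq m] [DecidableEq n]

/-! ## §1 The skew jet and its Leibniz characterisation -/

/-- [our object] **THE SKEW (COLOUR-STRIPPED) JET OF THE COPROJECTOR** along a stripped column variation `Y`: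
`cojetSkew X Y := −(R·Y·X⁺ − (R·Y·X⁺)ᴴ)`, `R = coproj X`, `X⁺ = pinv X`. -/
noncomputable def cojetSkew (X Y : Matrix n m 𝕜) : Matrix n n 𝕜 := -(coproj X * Y * pinv X - (coproj X * Y * pinv X)ᴴ)

/-- [our object] Unfolding. -/
theorem cojetSkew_def (X Y : Matrix n m 𝕜) : cojetSkew X Y = -(coproj X * Y * pinv X - (coproj X * Y * pinv X)ᴴ) := rfl

/-- [folklore] The skew jet IS skew: `(Ṙ_s)ᴴ = −Ṙ_s`. -/
theorem cojetSkew_conjTranspose (X Y : Matrix n m 𝕜) : (cojetSkew X Y)ᴴ = -cojetSkew X Y := by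
  rw [cojetSkew, conjTranspose_neg, conjTranspose_sub, conjTranspose_conjTranspose, neg_neg, neg_sub]

/-- [folklore] Additivity in the variation. -/
theorem cojetSkew_add (X Y Y' : Matrix n m 𝕜) : cojetSkew X (Y + Y') = cojetSkew X Y + cojetSkew X Y' := by
  simp only [cojetSkew, Matrix.mul_add, Matrix.add_mul, conjTranspose_add]
  abel

/-- [folklore] `cojetSkew X (−Y) = −cojetSkew X Y`. -/
theorem cojetSkew_neg (X Y : Matrix n m 𝕜) : cojetSkew X (-Y) = -cojetSkew X Y := by
  simp only [cojetSkew, Matrix.mul_neg, Matrix.neg_mul, conjTranspose_neg]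
  abel

/-- [folklore] `R · Ṙ_s = −R·Y·X⁺`. -/
theorem coproj_mul_cojetSkew {X : Matrix n m 𝕜} (hG : IsUnit (Xᴴ * X)) (Y : Matrix n m 𝕜) :
    coproj X * cojetSkew X Y = -(coproj X * Y * pinv X) := by
  rw [cojetSkew, Matrix.mul_neg, Matrix.mul_sub, coproj_mul_term hG, coproj_mul_term_conjTranspose hG, sub_zero]

/-- [folklore] `Ṙ_s · R = (R·Y·X⁺)ᴴ`. -/
theorem cojetSkew_mul_coproj {X : Matrix n m 𝕜} (hG : IsUnit (Xᴴ * X)) (Y : Matrix n m 𝕜) :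
    cojetSkew X Y * coproj X = (coproj X * Y * pinv X)ᴴ := by
  rw [cojetSkew, Matrix.neg_mul, Matrix.sub_mul, term_mul_coproj hG, term_conjTranspose_mul_coproj hG, zero_sub, neg_neg]

/-- [folklore] **LEIBNIZ FOR `R² = R`** (stripped): `R·Ṙ_s + Ṙ_s·R = Ṙ_s`. -/
theorem coproj_mul_cojetSkew_add_cojetSkew_mul_coproj {X : Matrix n m 𝕜} (hG : IsUnit (Xᴴ * X)) (Y : Matrix n m 𝕜) :
    coproj X * cojetSkew X Y + cojetSkew X Y * coproj X = cojetSkew X Y := by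
  rw [coproj_mul_cojetSkew hG, cojetSkew_mul_coproj hG, cojetSkew, neg_sub, sub_eq_neg_add]

/-- [folklore] **LEIBNIZ FOR `R·X = 0`** (stripped): `Ṙ_s·X + R·Y = 0`. -/
theorem cojetSkew_mul_self_add {X : Matrix n m 𝕜} (hG : IsUnit (Xᴴ * X)) (Y : Matrix n m 𝕜) :
    cojetSkew X Y * X + coproj X * Y = 0 := by
  rw [cojetSkew, Matrix.neg_mul, Matrix.sub_mul, term_mul_self hG, term_conjTranspose_mul_self hG, sub_zero, neg_add_cancel]

/-- [folklore] **OFF-DIAGONALITY**: `R·Ṙ_s·R = 0`. -/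
theorem coproj_mul_cojetSkew_mul_coproj {X : Matrix n m 𝕜} (hG : IsUnit (Xᴴ * X)) (Y : Matrix n m 𝕜) :
    coproj X * cojetSkew X Y * coproj X = 0 := by
  rw [coproj_mul_cojetSkew hG, Matrix.neg_mul, term_mul_coproj hG, neg_zero]

/-- [folklore] **OFF-DIAGONALITY**: `P·Ṙ_s·P = 0`, `P = 1 − R`. -/
theorem proj_mul_cojetSkew_mul_proj {X : Matrix n m 𝕜} (hG : IsUnit (Xᴴ * X)) (Y : Matrix n m 𝕜) :
    (1 - coproj X) * cojetSkew X Y * (1 - coproj X) = 0 := by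
  have e : (1 - coproj X) * cojetSkew X Y * (1 - coproj X) =
      cojetSkew X Y - coproj X * cojetSkew X Y - cojetSkew X Y * coproj X + coproj X * cojetSkew X Y * coproj X := by
    noncomm_ring
  rw [e, coproj_mul_cojetSkew_mul_coproj hG, coproj_mul_cojetSkew hG, cojetSkew_mul_coproj hG, cojetSkew_def]
  abel

/-- [folklore] The `R·(…)·P` corner of the skew jet is `−R·Y·X⁺` (the same as for `cojet`). -/
theorem coproj_mul_cojetSkew_mul_proj {X : Matrix n m 𝕜} (hG : IsUnit (Xᴴ * X)) (Y : Matrix n m 𝕜) :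
    coproj X * cojetSkew X Y * (1 - coproj X) = -(coproj X * Y * pinv X) := by
  rw [Matrix.mul_sub, Matrix.mul_one, coproj_mul_cojetSkew_mul_coproj hG, sub_zero, coproj_mul_cojetSkew hG]

/-- [folklore] **UNIQUENESS OF THE SKEW JET** (hypothesis-free): a SKEW `Z` with `R·Z + Z·R = Z` and `Z·X + R·Y = 0` IS `cojetSkew X Y`.
(As for `cojet_unique`, with `(Z·R)ᴴ = −R·Z`: `Z·R = Z + T`, `R·Z = Z − Tᴴ`, `T := R·Y·X⁺`; add.) -/
theorem cojetSkew_unique {X Y : Matrix n m 𝕜} {Z : Matrix n n 𝕜} (hZh : Zᴴ = -Z) (hZR : coproj X * Z + Z * coproj X = Z)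
    (hZX : Z * X + coproj X * Y = 0) : Z = cojetSkew X Y := by
  set T := coproj X * Y * pinv X with hT
  have h0 : Z * X = -(coproj X * Y) := eq_neg_of_add_eq_zero_left hZX
  have h1 : Z - Z * coproj X = -T := by
    calc Z - Z * coproj X = Z * (1 - coproj X) := by rw [Matrix.mul_sub, Matrix.mul_one]
      _ = Z * X * pinv X := by rw [← self_mul_pinv, Matrix.mul_assoc]
      _ = -T := by rw [h0, Matrix.neg_mul]
  have h2 : Z * coproj X = Z + T := by
    rw [← sub_sub_cancel Z (Z * coproj X), h1, sub_neg_eq_add]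
  have h3 : coproj X * Z = Z - Tᴴ := by
    have h := congrArg conjTranspose h2
    rw [conjTranspose_mul, coproj_conjTranspose, hZh, conjTranspose_add, hZh, Matrix.mul_neg] at h
    have h' : coproj X * Z = -(-Z + Tᴴ) := by rw [← h, neg_neg]
    rw [h', neg_add, neg_neg, sub_eq_add_neg]
  have h4 : Z = Z - Tᴴ + (Z + T) := by rw [← h3, ← h2]; exact hZR.symm
  have h5 : Z + (T - Tᴴ) = 0 := by
    calc Z + (T - Tᴴ) = (Z - Tᴴ + (Z + T)) - Z := by abel
      _ = Z - Z := by rw [← h4]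
      _ = 0 := sub_self Z
  rw [cojetSkew, ← hT]
  exact eq_neg_of_add_eq_zero_left h5

/-- [folklore] The two Leibniz identities and skewness CHARACTERISE the stripped jet. -/
theorem eq_cojetSkew_iff {X : Matrix n m 𝕜} (hG : IsUnit (Xᴴ * X)) (Y : Matrix n m 𝕜) (Z : Matrix n n 𝕜) :
    Z = cojetSkew X Y ↔ Zᴴ = -Z ∧ coproj X * Z + Z * coproj X = Z ∧ Z * X + coproj X * Y = 0 := by
  constructor
  · rintro rfl
    exact ⟨cojetSkew_conjTranspose X Y, coproj_mul_cojetSkew_add_cojetSkew_mul_coproj hG Y, cojetSkew_mul_self_add hG Y⟩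
  · rintro ⟨h1, h2, h3⟩
    exact cojetSkew_unique h1 h2 h3

/-! ## §2 The colour-stripping lemma (Kronecker form) -/

variable {c : Type*} [Fintype c] [DecidableEq c]

/-- [folklore] **THE U = 1 COPROJECTOR IS COLOUR-BLIND**: `coproj (X ⊗ₖ 1) = coproj X ⊗ₖ 1`. -/
theorem coproj_kronecker_one (X : Matrix n m 𝕜) : coproj (X ⊗ₖ (1 : Matrix c c 𝕜)) = coproj X ⊗ₖ (1 : Matrix c c 𝕜) := by
  rw [coproj, coproj, conjTranspose_kronecker, conjTranspose_one, ← mul_kronecker_mul, Matrix.one_mul, inv_kronecker, inv_one,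
    ← mul_kronecker_mul, Matrix.mul_one, ← mul_kronecker_mul, Matrix.mul_one, ← one_kronecker_one, sub_kronecker]

omit [DecidableEq n] in
/-- [folklore] `pinv (X ⊗ₖ 1) = pinv X ⊗ₖ 1`. -/
theorem pinv_kronecker_one (X : Matrix n m 𝕜) : pinv (X ⊗ₖ (1 : Matrix c c 𝕜)) = pinv X ⊗ₖ (1 : Matrix c c 𝕜) := by
  rw [pinv, pinv, conjTranspose_kronecker, conjTranspose_one, ← mul_kronecker_mul, Matrix.one_mul, inv_kronecker, inv_one,
    ← mul_kronecker_mul, Matrix.one_mul]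

/-- [folklore] The basic term: `R_full · (Y ⊗ₖ A) · X⁺_full = (R·Y·X⁺) ⊗ₖ A`. -/
theorem term_kronecker (X Y : Matrix n m 𝕜) (A : Matrix c c 𝕜) :
    coproj (X ⊗ₖ (1 : Matrix c c 𝕜)) * (Y ⊗ₖ A) * pinv (X ⊗ₖ (1 : Matrix c c 𝕜)) = (coproj X * Y * pinv X) ⊗ₖ A := by
  rw [coproj_kronecker_one, pinv_kronecker_one, ← mul_kronecker_mul, Matrix.one_mul, ← mul_kronecker_mul, Matrix.mul_one]

/-- [folklore] The full jet along a colour-dressed variation, for ANY colour matrix `A`: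
`cojet (X ⊗ₖ 1) (Y ⊗ₖ A) = −((R·Y·X⁺) ⊗ₖ A + (R·Y·X⁺)ᴴ ⊗ₖ Aᴴ)`. -/
theorem cojet_kronecker (X Y : Matrix n m 𝕜) (A : Matrix c c 𝕜) :
    cojet (X ⊗ₖ (1 : Matrix c c 𝕜)) (Y ⊗ₖ A) = -((coproj X * Y * pinv X) ⊗ₖ A + (coproj X * Y * pinv X)ᴴ ⊗ₖ Aᴴ) := by
  rw [cojet, term_kronecker, conjTranspose_kronecker]

/-- [folklore] **THE STRIPPING LEMMA.**  For a SKEW colour insertion (`Aᴴ = −A`, e.g. `A = ad(t_c)` for the Killing form):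
`cojet (X ⊗ₖ 1) (Y ⊗ₖ A) = cojetSkew X Y ⊗ₖ A` — the colour-stripped jet of the coprojector is the SKEW jet. -/
theorem cojet_kronecker_of_skew (X Y : Matrix n m 𝕜) {A : Matrix c c 𝕜} (hA : Aᴴ = -A) :
    cojet (X ⊗ₖ (1 : Matrix c c 𝕜)) (Y ⊗ₖ A) = cojetSkew X Y ⊗ₖ A := by
  rw [cojet_kronecker, hA, kronecker_neg, ← sub_eq_add_neg, ← sub_kronecker, cojetSkew, neg_kronecker]

/-- [folklore] For a HERMITIAN colour insertion (`Aᴴ = A`, e.g. the abelian case `A = 1`) the stripped jet is `cojet` itself: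
`cojet (X ⊗ₖ 1) (Y ⊗ₖ A) = cojet X Y ⊗ₖ A`. -/
theorem cojet_kronecker_of_isHermitian (X Y : Matrix n m 𝕜) {A : Matrix c c 𝕜} (hA : Aᴴ = A) :
    cojet (X ⊗ₖ (1 : Matrix c c 𝕜)) (Y ⊗ₖ A) = cojet X Y ⊗ₖ A := by
  rw [cojet_kronecker, hA, ← add_kronecker, cojet, neg_kronecker]

/-- [folklore] Consistency: the full jet along a skew-dressed variation is Hermitian although its stripped factor is skew
(`(Z_s ⊗ₖ A)ᴴ = Z_sᴴ ⊗ₖ Aᴴ = (−Z_s) ⊗ₖ (−A)`). -/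
theorem cojetSkew_kronecker_conjTranspose (X Y : Matrix n m 𝕜) {A : Matrix c c 𝕜} (hA : Aᴴ = -A) :
    (cojetSkew X Y ⊗ₖ A)ᴴ = cojetSkew X Y ⊗ₖ A := by
  rw [← cojet_kronecker_of_skew X Y hA, ProjectorJet.cojet_conjTranspose]

/-! ## §3 The [B9] (3.25) instance, stripped: `X = H⁻¹Qᴴ`, `Ḣ = V` SKEW (stripped), constraint jet `Q̇` -/

/-- [folklore] **THE STRIPPED JET OF BAŁABAN'S `R` ALONG `(Ḣ, Q̇) = (V, Q̇)`** for the column family `X = H⁻¹Qᴴ` and the stripped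
variation `Ẋ = −H⁻¹·V·X + H⁻¹·Q̇ᴴ` (any `H V Q Q̇`):
`Ṙ_s = R·H⁻¹·V·P − (R·H⁻¹·V·P)ᴴ − (R·H⁻¹·Q̇ᴴ·X⁺ − (R·H⁻¹·Q̇ᴴ·X⁺)ᴴ)`, `P = 1 − R`, `X⁺ = pinv X`. -/
theorem cojetSkew_balaban (H V : Matrix n n 𝕜) (Q Q' : Matrix m n 𝕜) :
    cojetSkew (H⁻¹ * Qᴴ) (-(H⁻¹ * V * (H⁻¹ * Qᴴ)) + H⁻¹ * Q'ᴴ) =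
      coproj (H⁻¹ * Qᴴ) * H⁻¹ * V * (1 - coproj (H⁻¹ * Qᴴ)) - (coproj (H⁻¹ * Qᴴ) * H⁻¹ * V * (1 - coproj (H⁻¹ * Qᴴ)))ᴴ -
        (coproj (H⁻¹ * Qᴴ) * H⁻¹ * Q'ᴴ * pinv (H⁻¹ * Qᴴ) - (coproj (H⁻¹ * Qᴴ) * H⁻¹ * Q'ᴴ * pinv (H⁻¹ * Qᴴ))ᴴ) := by
  set X := H⁻¹ * Qᴴ with hX
  have hP : 1 - coproj X = X * pinv X := (self_mul_pinv X).symm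
  have e1 : coproj X * (-(H⁻¹ * V * X) + H⁻¹ * Q'ᴴ) * pinv X =
      -(coproj X * H⁻¹ * V * (1 - coproj X)) + coproj X * H⁻¹ * Q'ᴴ * pinv X := by
    rw [hP]; simp only [Matrix.mul_add, Matrix.add_mul, Matrix.mul_neg, Matrix.neg_mul, Matrix.mul_assoc]
  rw [cojetSkew, e1, conjTranspose_add, conjTranspose_neg]
  abel

/-- [folklore] The same with `H` Hermitian and `V` SKEW (`Vᴴ = −V`, the stripped jet of a symmetric operator): the adjoint of the
`V`-corner is `−P·V·H⁻¹·R`, so **`Ṙ_s = R·H⁻¹·V·P + P·V·H⁻¹·R − (R·H⁻¹·Q̇ᴴ·X⁺ − (R·H⁻¹·Q̇ᴴ·X⁺)ᴴ)`** — the `V`-part has the SAME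
shape as in the Hermitian reading (`ProjectorJet.cojet_balaban_of_isHermitian`), the two `Q̇`-corners now enter with OPPOSITE signs. -/
theorem cojetSkew_balaban_of_skew {H V : Matrix n n 𝕜} (hH : H.IsHermitian) (hV : Vᴴ = -V) (Q Q' : Matrix m n 𝕜) :
    cojetSkew (H⁻¹ * Qᴴ) (-(H⁻¹ * V * (H⁻¹ * Qᴴ)) + H⁻¹ * Q'ᴴ) =
      coproj (H⁻¹ * Qᴴ) * H⁻¹ * V * (1 - coproj (H⁻¹ * Qᴴ)) + (1 - coproj (H⁻¹ * Qᴴ)) * V * H⁻¹ * coproj (H⁻¹ * Qᴴ) -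
        (coproj (H⁻¹ * Qᴴ) * H⁻¹ * Q'ᴴ * pinv (H⁻¹ * Qᴴ) - (coproj (H⁻¹ * Qᴴ) * H⁻¹ * Q'ᴴ * pinv (H⁻¹ * Qᴴ))ᴴ) := by
  have hHi : (H⁻¹)ᴴ = H⁻¹ := by rw [conjTranspose_nonsing_inv, hH.eq]
  have hadj : (coproj (H⁻¹ * Qᴴ) * H⁻¹ * V * (1 - coproj (H⁻¹ * Qᴴ)))ᴴ =
      -((1 - coproj (H⁻¹ * Qᴴ)) * V * H⁻¹ * coproj (H⁻¹ * Qᴴ)) := by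
    rw [conjTranspose_mul, conjTranspose_mul, conjTranspose_mul, conjTranspose_sub, conjTranspose_one, coproj_conjTranspose, hHi,
      hV, Matrix.neg_mul, Matrix.mul_neg]
    simp only [Matrix.mul_assoc]
  rw [cojetSkew_balaban, hadj, sub_neg_eq_add]

/-- [folklore] **THE STRIPPING LEMMA AT THE (3.25) INSTANCE**: the full jet of `R` along the colour-dressed variation
`(−H⁻¹·V·X + H⁻¹·Q̇ᴴ) ⊗ₖ A`, `Aᴴ = −A`, of the colour-blind column family `X ⊗ₖ 1` is `Ṙ_s ⊗ₖ A` with `Ṙ_s` the skew closed form. -/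
theorem cojet_balaban_kronecker_of_skew (H V : Matrix n n 𝕜) (Q Q' : Matrix m n 𝕜) {A : Matrix c c 𝕜} (hA : Aᴴ = -A) :
    cojet ((H⁻¹ * Qᴴ) ⊗ₖ (1 : Matrix c c 𝕜)) ((-(H⁻¹ * V * (H⁻¹ * Qᴴ)) + H⁻¹ * Q'ᴴ) ⊗ₖ A) =
      cojetSkew (H⁻¹ * Qᴴ) (-(H⁻¹ * V * (H⁻¹ * Qᴴ)) + H⁻¹ * Q'ᴴ) ⊗ₖ A :=
  cojet_kronecker_of_skew _ _ hA

end Skew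

end Summit.QuantumFields.BalabanUV.Beta.D1BFx.ProjectorJetStripped
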